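import Mathlib.Analysis.Matrix.Order
import Literature.Analysis.Fourier.LpMultiplierConstant
import Literature.Analysis.Fourier.LpMultiplierDilation
import Literature.Barriers.AtomisticToContinuum.NoBVEstimatesMultiDLinearStep
import Literature.LinearAlgebra.Matrix.StrictlyHyperbolicPencil
import HarnessLib

/-!
# Rauch's linear step: reduction of `Rauch1986_LpMultiplier_forces_commutation` to a uniform
multiplier family for the phase symbols `exp(-in K(ξ) + E)`

`NoBVEstimatesMultiDLinearStep.lean` vendors as the named fact
`Rauch1986_LpMultiplier_forces_commutation` the assertion of [Rauch1986, Proof of Theorem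
p. 483, last sentence]: for a constant-coefficient system in Rauch's class at `0` and `T > 0`,
if Rauch's multiplier `M_T(ξ) = rauchSymbol A₀ A B₁ T ξ = exp(-TA₀⁻¹(2πi Σ ξ_l A_l + B₁))`
is an `Lᵖ` multiplier for some `1 < p < ∞`, `p ≠ 2`, then the `A₀⁻¹Aⱼ` commute. This file
carries out the elementary reductions of its proof:

* **Dilation.** `M_T(nξ) = exp(Σ_l (-inξ_l) K_l + E)` with the REAL matrices
  `K_l = 2πT A₀⁻¹A_l` and `E = -TA₀⁻¹B₁` (`rauchPhaseSymbol`, `rauchSymbol_smul`); since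
  `M_p` is dilation invariant with the same constant [BrennerThomeeWahlbin1975, Ch. 1
  Thm 2.8] (`IsLpMultiplierWith.comp_smul`), `M_T ∈ M_p` gives the UNIFORM family
  `sup_n M_p(rauchPhaseSymbol K E n) < ∞` (`UniformPhaseFamily`,
  `uniformPhaseFamily_of_isLpMultiplier_rauchSymbol`).
  For `E = 0` this is "`M_p(exp(nP̂)) = M_p(exp(P̂))`" of [BrennerThomeeWahlbin1975, Ch. 5
  §1 (1.5)]; with the zeroth-order term `E` the dilates are no longer powers of one symbol.
* **The two branches of Rauch's class** for the pencil `K`: in the strictly hyperbolic branch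
  `K` is a strictly hyperbolic pencil (`isStrictlyHyperbolicPencil_of_isStrictlyHyperbolicAt`,
  `isStrictlyHyperbolicPencil_rauchPencil`: bridge to
  `Literature.LinearAlgebra.Matrix.IsStrictlyHyperbolicPencil`); in the
  symmetrizable branch (`Sym A₀` symmetric positive definite, `Sym Aⱼ` symmetric) one has
  `K_l = R⁻¹K'_lR` with `R = (Sym A₀)^{1/2}` and SYMMETRIC `K'_l`
  (`exists_conj_isSymm_of_symmetrizer`, `exists_conj_isSymm_rauchPencil`), the phase symbols
  are conjugate by the constant matrix `R` (`rauchPhaseSymbol_conj`), and a uniform family for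
  `(K, E)` is a uniform family for `(R⁻¹KR, R⁻¹ER)` (`UniformPhaseFamily.conj`)
  [BrennerThomeeWahlbin1975, Ch. 5 §1 (1.3)].
* Commutation of the `A₀⁻¹Aⱼ` is commutation of the `K_j`, resp. of the `K'_j`
  (`commute_of_commute_smul`, `commute_of_commute_rauchPencil`, `commute_of_commute_conj`).

What is NOT here: the analytic core — that a uniform multiplier family for
`rauchPhaseSymbol K E`, `p ≠ 2`, forces linear eigenvalues of the pencil `K` (symmetric or
strictly hyperbolic) — and the final assembly.

## References

* [Rauch1986] J. Rauch, Comm. Math. Phys. 106 (1986) 481–484, Proof of Theorem p. 483.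
* [BrennerThomeeWahlbin1975] P. Brenner, V. Thomée, L. B. Wahlbin, LNM 434 (1975), Ch. 1
  Thm 2.8; Ch. 5 §1 (1.3), (1.5).
-/

noncomputable section

open scoped ENNReal NNReal MatrixOrder Matrix

namespace Literature.Barriers.AtomisticToContinuum

open Literature.Analysis.Fourier Literature.LinearAlgebra.Matrix QuasilinearSystem

variable {d k : ℕ}

/-! ### The phase symbols `exp(Σ (-inξ_l)K_l + E)` -/

/-- **The phase symbol** `exp(Σ_l (-inξ_l) K_l + E)` of a real pencil `K` and a real matrix
`E` (complexified): Rauch's multiplier at time `T`, dilated by `n`, for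
`K_l = 2πTA₀⁻¹A_l`, `E = -TA₀⁻¹B₁` (`rauchSymbol_smul`).
[cite: Rauch1986, Proof of Theorem p. 483] -/
def rauchPhaseSymbol (K : Fin d → Matrix (Fin k) (Fin k) ℝ) (E : Matrix (Fin k) (Fin k) ℝ)
    (n : ℝ) (ξ : Space d) : Matrix (Fin k) (Fin k) ℂ :=
  NormedSpace.exp ((∑ l, (-(Complex.I * n * ξ l)) • (K l).map (algebraMap ℝ ℂ)) +
    E.map (algebraMap ℝ ℂ))

/-- The pencil of Rauch's linear step: `K_l = 2πT A₀⁻¹A_l`.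
[cite: Rauch1986, Proof of Theorem p. 483] -/
def rauchPencil (A₀ : Matrix (Fin k) (Fin k) ℝ) (A : Fin d → Matrix (Fin k) (Fin k) ℝ) (T : ℝ)
    (l : Fin d) : Matrix (Fin k) (Fin k) ℝ :=
  (2 * Real.pi * T) • (A₀⁻¹ * A l)

/-- The zeroth-order matrix of Rauch's linear step: `E = -T A₀⁻¹B₁`.
[cite: Rauch1986, Proof of Theorem p. 483] -/
def rauchZeroth (A₀ : Matrix (Fin k) (Fin k) ℝ) (B₁ : (Fin k → ℝ) →L[ℝ] (Fin k → ℝ)) (T : ℝ) :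
    Matrix (Fin k) (Fin k) ℝ :=
  -(T • (A₀⁻¹ * LinearMap.toMatrix' (B₁ : (Fin k → ℝ) →ₗ[ℝ] (Fin k → ℝ))))

/-- Complexification of real matrices commutes with products. [folklore] -/
theorem map_mul_ofReal (M N : Matrix (Fin k) (Fin k) ℝ) :
    (M * N).map (algebraMap ℝ ℂ) = M.map (algebraMap ℝ ℂ) * N.map (algebraMap ℝ ℂ) :=
  Matrix.map_mul

/-- Complexification of real matrices commutes with real scalars. [folklore] -/
theorem map_smul_ofReal (c : ℝ) (M : Matrix (Fin k) (Fin k) ℝ) :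
    (c • M).map (algebraMap ℝ ℂ) = (c : ℂ) • M.map (algebraMap ℝ ℂ) := by
  ext i j
  simp [Matrix.map_apply]

/-- **Dilates of Rauch's multiplier are phase symbols**:
`rauchSymbol A₀ A B₁ T (nξ) = rauchPhaseSymbol (rauchPencil A₀ A T) (rauchZeroth A₀ B₁ T) n ξ`.
[cite: Rauch1986, Proof of Theorem p. 483] -/
theorem rauchSymbol_smul (A₀ : Matrix (Fin k) (Fin k) ℝ) (A : Fin d → Matrix (Fin k) (Fin k) ℝ)
    (B₁ : (Fin k → ℝ) →L[ℝ] (Fin k → ℝ)) (T n : ℝ) (ξ : Space d) :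
    rauchSymbol A₀ A B₁ T (n • ξ) =
      rauchPhaseSymbol (rauchPencil A₀ A T) (rauchZeroth A₀ B₁ T) n ξ := by
  unfold rauchSymbol rauchPhaseSymbol rauchGenerator rauchPencil rauchZeroth
  congr 1
  rw [Matrix.mul_add, smul_add, Finset.mul_sum, Finset.smul_sum]
  congr 1
  · refine Finset.sum_congr rfl fun l _ => ?_
    rw [map_smul_ofReal, map_mul_ofReal, Matrix.mul_smul, smul_smul, smul_smul, PiLp.smul_apply,
      smul_eq_mul]
    congr 1
    push_cast
    ring
  · rw [Matrix.map_neg _ (map_neg (algebraMap ℝ ℂ)), map_smul_ofReal, map_mul_ofReal, neg_smul]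

/-! ### Uniform multiplier families -/

/-- **A uniform `Lᵖ` multiplier family for the phase symbols**: one constant `C` with
`rauchPhaseSymbol K E n ∈ M_p` (constant `C`) for every `n ≠ 0`.
[cite: BrennerThomeeWahlbin1975, Ch. 5 §1 (1.5)] -/
def UniformPhaseFamily (p : ℝ≥0∞) (K : Fin d → Matrix (Fin k) (Fin k) ℝ)
    (E : Matrix (Fin k) (Fin k) ℝ) : Prop :=
  ∃ C : ℝ≥0, ∀ n : ℝ, n ≠ 0 → IsLpMultiplierWith p C (rauchPhaseSymbol K E n)

/-- **Dilation** [BrennerThomeeWahlbin1975, Ch. 1 Thm 2.8]: if Rauch's multiplier at time `T`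
is in `M_p`, the phase symbols `M_T(n·)` form a uniform family.
[cite: BrennerThomeeWahlbin1975, Ch. 1 Thm 2.8; Rauch1986, Proof of Theorem p. 483] -/
theorem uniformPhaseFamily_of_isLpMultiplier_rauchSymbol {p : ℝ≥0∞}
    {A₀ : Matrix (Fin k) (Fin k) ℝ} {A : Fin d → Matrix (Fin k) (Fin k) ℝ}
    {B₁ : (Fin k → ℝ) →L[ℝ] (Fin k → ℝ)} {T : ℝ} (h : IsLpMultiplier p (rauchSymbol A₀ A B₁ T)) :
    UniformPhaseFamily p (rauchPencil A₀ A T) (rauchZeroth A₀ B₁ T) := by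
  obtain ⟨C, hC⟩ := h
  refine ⟨C, fun n hn => ?_⟩
  have h1 := hC.comp_smul hn
  have heq : (fun ξ : Space d => rauchSymbol A₀ A B₁ T (n • ξ)) =
      rauchPhaseSymbol (rauchPencil A₀ A T) (rauchZeroth A₀ B₁ T) n :=
    funext fun ξ => rauchSymbol_smul A₀ A B₁ T n ξ
  rwa [heq] at h1

/-! ### Conjugation by a constant matrix -/

/-- Conjugating `K` and `E` by an invertible real matrix conjugates the phase symbols
(complexified): `rauchPhaseSymbol (R⁻¹KR) (R⁻¹ER) n ξ = R⁻¹ (rauchPhaseSymbol K E n ξ) R`.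
[cite: BrennerThomeeWahlbin1975, Ch. 5 §1, proof of Thm 1.1] -/
theorem rauchPhaseSymbol_conj (K : Fin d → Matrix (Fin k) (Fin k) ℝ) (E R : Matrix (Fin k) (Fin k) ℝ)
    (hR : IsUnit R.det) (n : ℝ) (ξ : Space d) :
    rauchPhaseSymbol (fun l => R⁻¹ * K l * R) (R⁻¹ * E * R) n ξ =
      (R⁻¹).map (algebraMap ℝ ℂ) * rauchPhaseSymbol K E n ξ * R.map (algebraMap ℝ ℂ) := by
  set Rc : Matrix (Fin k) (Fin k) ℂ := R.map (algebraMap ℝ ℂ) with hRc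
  set Ric : Matrix (Fin k) (Fin k) ℂ := (R⁻¹).map (algebraMap ℝ ℂ) with hRic
  have hRR : Rc * Ric = 1 := by
    rw [hRc, hRic, ← Matrix.map_mul, Matrix.mul_nonsing_inv _ hR,
      Matrix.map_one _ (map_zero _) (map_one _)]
  have hRcu : IsUnit Rc := IsUnit.of_mul_eq_one _ hRR
  have hinv : Rc⁻¹ = Ric := Matrix.inv_eq_right_inv hRR
  have hexpo : (∑ l, (-(Complex.I * n * ξ l)) • (R⁻¹ * K l * R).map (algebraMap ℝ ℂ)) +
      (R⁻¹ * E * R).map (algebraMap ℝ ℂ) =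
      Rc⁻¹ * ((∑ l, (-(Complex.I * n * ξ l)) • (K l).map (algebraMap ℝ ℂ)) +
        E.map (algebraMap ℝ ℂ)) * Rc := by
    rw [hinv, Matrix.mul_add, Matrix.add_mul, Finset.mul_sum, Finset.sum_mul]
    congr 1
    · refine Finset.sum_congr rfl fun l _ => ?_
      rw [map_mul_ofReal, map_mul_ofReal, Matrix.mul_smul, Matrix.smul_mul]
    · rw [map_mul_ofReal, map_mul_ofReal]
  unfold rauchPhaseSymbol
  rw [hexpo, ← hinv]
  exact Matrix.exp_conj' Rc _ hRcu

/-- Constant conjugation preserves uniform families: if `(K, E)` has a uniform family then so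
does `(R⁻¹KR, R⁻¹ER)` (the constants change by `‖R‖‖R⁻¹‖`).
[cite: BrennerThomeeWahlbin1975, Ch. 5 §1 (1.3)] -/
theorem UniformPhaseFamily.conj {p : ℝ≥0∞} {K : Fin d → Matrix (Fin k) (Fin k) ℝ}
    {E : Matrix (Fin k) (Fin k) ℝ} (h : UniformPhaseFamily p K E) (R : Matrix (Fin k) (Fin k) ℝ)
    (hR : IsUnit R.det) : UniformPhaseFamily p (fun l => R⁻¹ * K l * R) (R⁻¹ * E * R) := by
  obtain ⟨C, hC⟩ := h
  refine ⟨‖LinearMap.toContinuousLinearMap (Matrix.mulVecLin ((R⁻¹).map (algebraMap ℝ ℂ)))‖₊ *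
    C * ‖LinearMap.toContinuousLinearMap (Matrix.mulVecLin (R.map (algebraMap ℝ ℂ)))‖₊,
    fun n hn => ?_⟩
  have h1 := ((hC n hn).const_mul ((R⁻¹).map (algebraMap ℝ ℂ))).mul_const (R.map (algebraMap ℝ ℂ))
  have heq : (fun ξ => (R⁻¹).map (algebraMap ℝ ℂ) * rauchPhaseSymbol K E n ξ * R.map (algebraMap ℝ ℂ))
      = rauchPhaseSymbol (fun l => R⁻¹ * K l * R) (R⁻¹ * E * R) n :=
    funext fun ξ => (rauchPhaseSymbol_conj K E R hR n ξ).symm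
  rwa [heq] at h1

/-! ### The two branches of Rauch's class -/

/-- **Strictly hyperbolic branch**: the pencil `A₀⁻¹Aⱼ` of a constant-coefficient system
that is strictly hyperbolic at some state (in the sense of `IsStrictlyHyperbolicAt`) is a
strictly hyperbolic pencil. [cite: Rauch1986, p. 482] -/
theorem isStrictlyHyperbolicPencil_of_isStrictlyHyperbolicAt {A₀ : Matrix (Fin k) (Fin k) ℝ}
    {A : Fin d → Matrix (Fin k) (Fin k) ℝ} {B₁ : (Fin k → ℝ) →L[ℝ] (Fin k → ℝ)} {u : Fin k → ℝ}
    (h : (ofConstant A₀ A B₁).IsStrictlyHyperbolicAt u) :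
    IsStrictlyHyperbolicPencil (fun j => A₀⁻¹ * A j) := by
  intro ξ hξ
  obtain ⟨lam, hinj, hv⟩ := h ξ hξ
  refine ⟨lam, hinj, fun i => ?_⟩
  obtain ⟨v, hv0, hv⟩ := hv i
  refine ⟨v, hv0, ?_⟩
  have heq : ∑ j, ξ j • (A₀⁻¹ * A j) =
      ((ofConstant A₀ A B₁).A0 u)⁻¹ * ∑ j, ξ j • (ofConstant A₀ A B₁).A j u := by
    simp only [ofConstant_A0, ofConstant_A, Finset.mul_sum, Matrix.mul_smul]
  rw [heq]
  exact hv

/-- Scaling a strictly hyperbolic pencil by `c ≠ 0` keeps it strictly hyperbolic (eigenvalues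
`cλᵢ`). [folklore] -/
theorem IsStrictlyHyperbolicPencil.smul {K : Fin d → Matrix (Fin k) (Fin k) ℝ}
    (h : IsStrictlyHyperbolicPencil K) {c : ℝ} (hc : c ≠ 0) :
    IsStrictlyHyperbolicPencil (fun j => c • K j) := by
  intro ξ hξ
  obtain ⟨lam, hinj, hv⟩ := h ξ hξ
  refine ⟨fun i => c * lam i, fun i j hij => hinj (mul_left_cancel₀ hc hij), fun i => ?_⟩
  obtain ⟨v, hv0, hv⟩ := hv i
  refine ⟨v, hv0, ?_⟩
  have heq : ∑ j, ξ j • (c • K j) = c • ∑ j, ξ j • K j := by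
    rw [Finset.smul_sum]
    exact Finset.sum_congr rfl fun j _ => smul_comm _ _ _
  rw [heq, Matrix.smul_mulVec, hv, smul_smul]

/-- The pencil `rauchPencil A₀ A T` of a strictly hyperbolic constant-coefficient system,
`T ≠ 0`, is strictly hyperbolic. [cite: Rauch1986, pp. 482–483] -/
theorem isStrictlyHyperbolicPencil_rauchPencil {A₀ : Matrix (Fin k) (Fin k) ℝ}
    {A : Fin d → Matrix (Fin k) (Fin k) ℝ} {B₁ : (Fin k → ℝ) →L[ℝ] (Fin k → ℝ)} {u : Fin k → ℝ}
    (h : (ofConstant A₀ A B₁).IsStrictlyHyperbolicAt u) {T : ℝ} (hT : T ≠ 0) :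
    IsStrictlyHyperbolicPencil (rauchPencil A₀ A T) :=
  IsStrictlyHyperbolicPencil.smul (K := fun j => A₀⁻¹ * A j)
    (isStrictlyHyperbolicPencil_of_isStrictlyHyperbolicAt h)
    (mul_ne_zero (mul_ne_zero two_ne_zero Real.pi_ne_zero) hT)

/-- **Symmetrizable branch: conjugation to a symmetric pencil.** If `Sym A₀` is symmetric
positive definite and the `Sym Aⱼ` are symmetric, then with `H = Sym A₀ = R²`, `R = H^{1/2}`,
one has `A₀⁻¹Aⱼ = R⁻¹KⱼR` for the SYMMETRIC matrices `Kⱼ = R⁻¹(Sym Aⱼ)R⁻¹`.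
[cite: Rauch1986, p. 482; BrennerThomeeWahlbin1975, Ch. 5 §1, proof of Thm 1.1] -/
theorem exists_conj_isSymm_of_symmetrizer (A₀ : Matrix (Fin k) (Fin k) ℝ)
    (A : Fin d → Matrix (Fin k) (Fin k) ℝ) (Sym : Matrix (Fin k) (Fin k) ℝ)
    (hH : (Sym * A₀).PosDef) (hS : ∀ j, (Sym * A j).IsSymm) :
    ∃ R : Matrix (Fin k) (Fin k) ℝ, IsUnit R.det ∧ ∃ K : Fin d → Matrix (Fin k) (Fin k) ℝ,
      (∀ j, (K j).IsSymm) ∧ ∀ j, A₀⁻¹ * A j = R⁻¹ * K j * R := by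
  set H : Matrix (Fin k) (Fin k) ℝ := Sym * A₀ with hHdef
  set R : Matrix (Fin k) (Fin k) ℝ := CFC.sqrt H with hRdef
  have hHnn : 0 ≤ H := Matrix.nonneg_iff_posSemidef.2 hH.posSemidef
  have hR2 : R * R = H := CFC.sqrt_mul_sqrt_self H hHnn
  have hRsa : IsSelfAdjoint R := (CFC.sqrt_nonneg H).isSelfAdjoint
  have hRt : Rᵀ = R := by
    have h := hRsa.star_eq
    rwa [Matrix.star_eq_conjTranspose, Matrix.conjTranspose_eq_transpose_of_trivial] at h
  have hdetH : H.det ≠ 0 := hH.det_pos.ne'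
  have hdetR : IsUnit R.det := by
    rw [isUnit_iff_ne_zero]
    intro h0
    apply hdetH
    rw [← hR2, Matrix.det_mul, h0, mul_zero]
  have hdetSym : IsUnit Sym.det := by
    rw [isUnit_iff_ne_zero]
    intro h0; apply hdetH; rw [hHdef, Matrix.det_mul, h0, zero_mul]
  set K : Fin d → Matrix (Fin k) (Fin k) ℝ := fun j => R⁻¹ * (Sym * A j) * R⁻¹ with hKdef
  refine ⟨R, hdetR, K, fun j => ?_, fun j => ?_⟩
  · have hRit : (R⁻¹)ᵀ = R⁻¹ := by rw [Matrix.transpose_nonsing_inv, hRt]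
    change (R⁻¹ * (Sym * A j) * R⁻¹)ᵀ = R⁻¹ * (Sym * A j) * R⁻¹
    rw [Matrix.transpose_mul, Matrix.transpose_mul, hRit, (hS j).eq]
    simp only [Matrix.mul_assoc]
  · have h1 : A₀⁻¹ = H⁻¹ * Sym := by
      rw [hHdef, Matrix.mul_inv_rev, Matrix.mul_assoc, Matrix.nonsing_inv_mul _ hdetSym,
        Matrix.mul_one]
    have h2 : H⁻¹ = R⁻¹ * R⁻¹ := by rw [← hR2, Matrix.mul_inv_rev]
    rw [h1, h2, hKdef]
    simp only [Matrix.mul_assoc]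
    rw [Matrix.nonsing_inv_mul _ hdetR, Matrix.mul_one]

/-- The pencil `rauchPencil A₀ A T` of a symmetrizable system is conjugate to a SYMMETRIC
pencil: `rauchPencil A₀ A T j = R⁻¹ K'ⱼ R` with `K'ⱼ = 2πT Kⱼ` symmetric.
[cite: Rauch1986, pp. 482–483] -/
theorem exists_conj_isSymm_rauchPencil (A₀ : Matrix (Fin k) (Fin k) ℝ)
    (A : Fin d → Matrix (Fin k) (Fin k) ℝ) (Sym : Matrix (Fin k) (Fin k) ℝ)
    (hH : (Sym * A₀).PosDef) (hS : ∀ j, (Sym * A j).IsSymm) (T : ℝ) :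
    ∃ R : Matrix (Fin k) (Fin k) ℝ, IsUnit R.det ∧ ∃ K' : Fin d → Matrix (Fin k) (Fin k) ℝ,
      (∀ j, (K' j).IsSymm) ∧ ∀ j, rauchPencil A₀ A T j = R⁻¹ * K' j * R := by
  obtain ⟨R, hR, K, hK, hconj⟩ := exists_conj_isSymm_of_symmetrizer A₀ A Sym hH hS
  refine ⟨R, hR, fun j => (2 * Real.pi * T) • K j, fun j => (hK j).smul _, fun j => ?_⟩
  rw [rauchPencil, hconj j, Matrix.mul_smul, Matrix.smul_mul]

/-! ### Commutation bookkeeping -/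

/-- Commutation is invariant under a common nonzero scaling. [folklore] -/
theorem commute_of_commute_smul {M N : Matrix (Fin k) (Fin k) ℝ} {c : ℝ} (hc : c ≠ 0)
    (h : Commute (c • M) (c • N)) : Commute M N := by
  have h2 := h.eq
  simp only [Matrix.smul_mul, Matrix.mul_smul, smul_smul] at h2
  exact smul_right_injective _ (mul_ne_zero hc hc) h2

/-- Commutation is invariant under conjugation by an invertible matrix. [folklore] -/
theorem commute_of_commute_conj {M N R : Matrix (Fin k) (Fin k) ℝ} (hR : IsUnit R.det)
    (h : Commute (R⁻¹ * M * R) (R⁻¹ * N * R)) : Commute M N := by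
  have hRR' : R * R⁻¹ = 1 := Matrix.mul_nonsing_inv _ hR
  have hR'R : R⁻¹ * R = 1 := Matrix.nonsing_inv_mul _ hR
  have h2 : R⁻¹ * (M * N) * R = R⁻¹ * (N * M) * R := by
    calc R⁻¹ * (M * N) * R = R⁻¹ * M * (R * R⁻¹) * N * R := by
          rw [hRR', Matrix.mul_one]; simp only [Matrix.mul_assoc]
      _ = (R⁻¹ * M * R) * (R⁻¹ * N * R) := by simp only [Matrix.mul_assoc]
      _ = (R⁻¹ * N * R) * (R⁻¹ * M * R) := h.eq
      _ = R⁻¹ * N * (R * R⁻¹) * M * R := by simp only [Matrix.mul_assoc]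
      _ = R⁻¹ * (N * M) * R := by rw [hRR', Matrix.mul_one]; simp only [Matrix.mul_assoc]
  have h3 : R * (R⁻¹ * (M * N) * R) * R⁻¹ = R * (R⁻¹ * (N * M) * R) * R⁻¹ := by rw [h2]
  simp only [Matrix.mul_assoc, hRR', Matrix.mul_one] at h3
  simp only [← Matrix.mul_assoc, hRR', Matrix.one_mul] at h3
  exact h3

/-- Commutation of the `A₀⁻¹Aⱼ` is commutation of the pencil matrices `rauchPencil A₀ A T j`
(`T ≠ 0`). [cite: Rauch1986, (3) p. 482] -/
theorem commute_of_commute_rauchPencil {A₀ : Matrix (Fin k) (Fin k) ℝ}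
    {A : Fin d → Matrix (Fin k) (Fin k) ℝ} {T : ℝ} (hT : T ≠ 0) {j l : Fin d}
    (h : Commute (rauchPencil A₀ A T j) (rauchPencil A₀ A T l)) :
    Commute (A₀⁻¹ * A j) (A₀⁻¹ * A l) :=
  commute_of_commute_smul (mul_ne_zero (mul_ne_zero two_ne_zero Real.pi_ne_zero) hT) h

end Literature.Barriers.AtomisticToContinuum

end
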